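import Mathlib
import Summits.PneNP.PneNP.Theorems.ConvexRankGatesLinAlgGateBlindDenseRegime

/-!
# Route ConvexRankGates, crux `LinAlgGateBlind` (stmt-PneNP-10681): the MINTERM DOOR — the DNF-side counterpart of the small-clause door (supports)

Read the term gate through any DNF over clique atoms, `O(x) = ⋁_{T ∈ 𝒯} ⋀_{Z ∈ T} ⌈Z⌉` (`𝒯` = any family of terms,
e.g. the minterms of `O`; atoms `Z ∈ 𝒱(l)`), and call a term THIN if its vertex union `⋃ T` has at most `l`
vertices. The thin terms' unions form a small-clique DNF `𝒜 ⊆ 𝒱(l)` that never gains a negative (a clique on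
`⋃ T` switches every atom of `T` on), and a lost positive is a `k`-set containing the union of a FAT term:

* `sg_of_terms` — `gainedNeg = 0` and `#lostPos ≤ Σ_{T fat} C(m - #⋃T, k - #⋃T)`;
* `polyTerms_budget` — `m^a · C(m - (l+1), k - (l+1)) ≤ ε_c(m) · C(m, k)` eventually (`l ≥ 2(a + c) + 1`);
* `sgClause_of_card_terms_le` (registered) — hence, for all `a, c`, eventually in `m`, EVERY Boolean function
  of graphs with a DNF of at most `m^a` terms over `𝒱(lOf m)`-atoms satisfies the single-gate clause of the line
  at budget `epsOf c m`, whatever its class.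

With the program door and the small-clause door this completes the kernel-checked profile of a violator of
`SG_PERM` / `SG_GRANK` at gate parameter `m^c`: super-polynomial monotone program complexity over its atom-ORs,
big-only fragility on the CNF side, and on the DNF side a fat-minterm mass `Σ_{u > l} N_u · C(m-u, k-u) > ε·C(m,k)`
(`N_u` = number of minterms on `u` vertices) — the "`m^{Ω(k)}` near-clique minterms" of the refuter's bottleneck
lemma. Sources: A. A. Razborov (1985); N. Alon, R. B. Boppana, Combinatorica 7 (1987), §3 (lattice, one-sided
errors); S. Jukna, *Boolean Function Complexity* (2012), Thm. 9.26 (superset count). No new definitions; nothing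
is assumed. [folklore]
-/

-- `Summit.PneNP.PneNP.…` duplicates `PneNP` BY DESIGN (single-problem summit).
set_option linter.dupNamespace false

noncomputable section

namespace Summit.PneNP.PneNP.Theorems

open Finset Filter Literature.Computability.Complexity Razborov
open Summit.PneNP.PneNP.Cruxes.LinAlgGateBlind.DnfInvariantWideGatesSeeSmallCliques

/-! ### The door with explicit budgets -/

/-- The vertex union of a family of atoms from `𝒱(l)` is never a singleton (atoms are empty or have `≥ 2`
vertices). [folklore] -/
theorem card_biUnion_ne_one {m l : ℕ} {T : Finset (Finset (Fin m))}
    (hT : ∀ Z ∈ T, Z ∈ smallSets (Fin m) l) : #(T.biUnion id) ≠ 1 := by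
  classical
  intro h1
  obtain ⟨v, hv⟩ := card_eq_one.1 h1
  have hvmem : v ∈ T.biUnion id := by rw [hv]; exact mem_singleton_self v
  obtain ⟨Z, hZ, hvZ⟩ := mem_biUnion.1 hvmem
  have hZ1 : #Z ≠ 1 := (mem_smallSets.1 (hT Z hZ)).2
  have hZsub : Z ⊆ {v} := hv ▸ (subset_biUnion_of_mem id hZ)
  have hZle : #Z ≤ 1 := by simpa using card_le_card hZsub
  have hZpos : 0 < #Z := card_pos.2 ⟨v, hvZ⟩
  omega

/-- **The minterm door (explicit budgets).** Let `O(x) = 1 ↔ ∃ T ∈ 𝒯, ∀ Z ∈ T, ⌈Z⌉(x)` be a DNF of the term gate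
over atoms `Z ∈ 𝒱(l)`. With `𝒜 = {⋃ T : T ∈ 𝒯, #⋃T ≤ l}` no negative is gained, and the lost positives are the
`k`-sets containing the union of a fat term. [folklore] -/
theorem sg_of_terms (m k l : ℕ) (q : ℝ) (𝒯 : Finset (Finset (Finset (Fin m))))
    (h𝒯 : ∀ T ∈ 𝒯, ∀ Z ∈ T, Z ∈ smallSets (Fin m) l)
    (O : (KEdge m → Bool) → Bool) (hO : ∀ x, O x = true ↔ ∃ T ∈ 𝒯, ∀ Z ∈ T, CliquePresent Z x) :
    ∃ 𝒜 ⊆ smallSets (Fin m) l,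
      #(lostPos m k O 𝒜) ≤ ∑ T ∈ 𝒯.filter (fun T => l < #(T.biUnion id)),
          (m - #(T.biUnion id)).choose (k - #(T.biUnion id)) ∧
      gainedNeg m q O 𝒜 = 0 := by
  classical
  refine ⟨(𝒯.filter fun T => #(T.biUnion id) ≤ l).image fun T => T.biUnion id, ?_, ?_, ?_⟩
  · intro U hU
    obtain ⟨T, hT, rfl⟩ := mem_image.1 hU
    obtain ⟨hT𝒯, hTl⟩ := mem_filter.1 hT
    exact mem_smallSets.2 ⟨hTl, card_biUnion_ne_one (h𝒯 T hT𝒯)⟩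
  · -- lost positives contain the union of a fat term
    have hsub : lostPos m k O ((𝒯.filter fun T => #(T.biUnion id) ≤ l).image fun T => T.biUnion id) ⊆
        (𝒯.filter fun T => l < #(T.biUnion id)).biUnion fun T =>
          (powersetCard k (univ : Finset (Fin m))).filter fun S => T.biUnion id ⊆ S := by
      intro S hS
      simp only [lostPos, mem_filter, mem_powersetCard] at hS
      obtain ⟨⟨-, hSk⟩, hOS, hacc⟩ := hS
      obtain ⟨T, hT, hTS⟩ := (hO _).1 hOS
      have hUS : T.biUnion id ⊆ S := biUnion_subset.2 fun Z hZ =>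
        (cliquePresent_cliqueVec_iff (mem_smallSets.1 (h𝒯 T hT Z hZ)).2).1 (hTS Z hZ)
      have hfat : l < #(T.biUnion id) := by
        by_contra hle
        push Not at hle
        exact hacc ⟨T.biUnion id, mem_image.2 ⟨T, mem_filter.2 ⟨hT, hle⟩, rfl⟩,
          (cliquePresent_cliqueVec_iff (card_biUnion_ne_one (h𝒯 T hT))).2 hUS⟩
      exact mem_biUnion.2 ⟨T, mem_filter.2 ⟨hT, hfat⟩,
        mem_filter.2 ⟨mem_powersetCard.2 ⟨subset_univ _, hSk⟩, hUS⟩⟩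
    calc #(lostPos m k O ((𝒯.filter fun T => #(T.biUnion id) ≤ l).image fun T => T.biUnion id))
        ≤ ∑ T ∈ 𝒯.filter (fun T => l < #(T.biUnion id)),
            #((powersetCard k (univ : Finset (Fin m))).filter fun S => T.biUnion id ⊆ S) :=
          (card_le_card hsub).trans card_biUnion_le
      _ ≤ ∑ T ∈ 𝒯.filter (fun T => l < #(T.biUnion id)),
            (m - #(T.biUnion id)).choose (k - #(T.biUnion id)) := by
          refine sum_le_sum fun T _ => ?_
          by_cases hUk : #(T.biUnion id) ≤ k
          · calc #((powersetCard k (univ : Finset (Fin m))).filter fun S => T.biUnion id ⊆ S)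
                ≤ (#(univ : Finset (Fin m)) - #(T.biUnion id)).choose (k - #(T.biUnion id)) :=
                  card_filter_supset_powersetCard_le univ _ hUk
              _ = (m - #(T.biUnion id)).choose (k - #(T.biUnion id)) := by rw [card_univ, Fintype.card_fin]
          · have hempty : ((powersetCard k (univ : Finset (Fin m))).filter fun S => T.biUnion id ⊆ S) = ∅ := by
              refine filter_false_of_mem fun S hS h => hUk ?_
              rw [← (mem_powersetCard.1 hS).2]
              exact card_le_card h
            rw [hempty, card_empty]
            exact Nat.zero_le _
  · -- no gained negatives: a clique on `⋃ T` switches every atom of `T` on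
    unfold gainedNeg
    have he : (fun x : KEdge m → Bool => O x = false ∧
        Accepts ((𝒯.filter fun T => #(T.biUnion id) ≤ l).image fun T => T.biUnion id) x) = fun _ => False := by
      funext x
      apply propext
      constructor
      · rintro ⟨hOx, U, hU, hUx⟩
        obtain ⟨T, hT, rfl⟩ := mem_image.1 hU
        have h1 : O x = true :=
          (hO x).2 ⟨T, (mem_filter.1 hT).1, fun Z hZ => hUx.anti (subset_biUnion_of_mem id hZ)⟩
        rw [hOx] at h1
        exact Bool.false_ne_true h1
      · exact False.elim
    rw [he, prob_false]

/-! ### The door in the line's regime: every `c` -/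

/-- **Budget for polynomially many fat terms**: for all `a, c`, eventually in `m`,
`m^a · C(m - (l+1), k - (l+1)) ≤ ε_c(m) · C(m, k)` (`C(m-l-1,k-l-1)·m^{l+1} ≤ k^{l+1}·C(m,k)`, `k ≤ 2x²`,
`x = m^{1/16} ≥ 2`, `l ≥ 2(a+c) + 1`). [folklore] -/
theorem polyTerms_budget : ∀ a c : ℕ, ∀ᶠ m : ℕ in atTop, ((m : ℝ) ^ a * (((m - (lOf m + 1)).choose (kOf m - (lOf m + 1)) : ℕ) : ℝ)) ≤ epsOf c m * (m.choose (kOf m) : ℝ) := by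
  intro a c
  filter_upwards [denseRegime_params (a + c), eventually_ge_atTop 1,
    (DenseRegime.tendsto_rpow_sixteenth).eventually_ge_atTop (2 : ℝ)] with m hP hm hx2
  obtain ⟨-, -, -, hl2⟩ := hP
  set x := (m : ℝ) ^ (1 / 16 : ℝ) with hxdef
  set l := lOf m
  set k := kOf m
  have hlk : l + 1 ≤ k := DenseRegime.lOf_add_one_le_kOf hx2
  have hkm : k ≤ m := DenseRegime.kOf_le_self m
  have hnat := choose_sub_mul_pow_le_pow_mul_choose (l + 1) m k hlk hkm
  have hmx : (m : ℝ) = x ^ 16 := (DenseRegime.rpow_sixteenth_pow m).symm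
  have hmpos : (0 : ℝ) < m := by exact_mod_cast hm
  have hx1 : (1 : ℝ) ≤ x := by linarith
  have hk2 : (k : ℝ) ≤ 2 * x ^ 2 := DenseRegime.kOf_le_two_mul_sq hm
  have hreal : (((m - (l + 1)).choose (k - (l + 1)) : ℕ) : ℝ) * (m : ℝ) ^ (l + 1) ≤
      (k : ℝ) ^ (l + 1) * (m.choose k : ℝ) := by exact_mod_cast hnat
  have hC : (0 : ℝ) ≤ (m.choose k : ℝ) := Nat.cast_nonneg _
  have hl : 2 * (a + c) + 1 ≤ l := by omega
  have e1 : (2 * x ^ 2) ^ (l + 1) = (2 : ℝ) ^ (l + 1) * x ^ (2 * (l + 1)) := by rw [mul_pow, ← pow_mul]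
  have e2 : (4 : ℝ) * (x ^ 16) ^ (c + 1) = (2 : ℝ) ^ 2 * x ^ (16 * (c + 1)) := by rw [← pow_mul]; norm_num
  have e3 : (x ^ 16) ^ (l + 1) = x ^ (16 * (l + 1)) := by rw [← pow_mul]
  have e4 : (x ^ 16) ^ a = x ^ (16 * a) := by rw [← pow_mul]
  have key : (x ^ 16) ^ a * (2 * x ^ 2) ^ (l + 1) * (4 * (x ^ 16) ^ (c + 1)) ≤ (x ^ 16) ^ (l + 1) := by
    have h2x : (2 : ℝ) ^ (l + 1 + 2) ≤ x ^ (l + 3) := by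
      rw [show l + 1 + 2 = l + 3 by ring]
      exact pow_le_pow_left₀ (by norm_num) hx2 _
    rw [e1, e2, e3, e4]
    calc x ^ (16 * a) * ((2 : ℝ) ^ (l + 1) * x ^ (2 * (l + 1))) * ((2 : ℝ) ^ 2 * x ^ (16 * (c + 1)))
        = (2 : ℝ) ^ (l + 1 + 2) * (x ^ (16 * a) * x ^ (2 * (l + 1)) * x ^ (16 * (c + 1))) := by
          rw [pow_add]; ring
      _ ≤ x ^ (l + 3) * (x ^ (16 * a) * x ^ (2 * (l + 1)) * x ^ (16 * (c + 1))) :=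
          mul_le_mul_of_nonneg_right h2x (by positivity)
      _ = x ^ (l + 3 + (16 * a + 2 * (l + 1) + 16 * (c + 1))) := by ring
      _ ≤ x ^ (16 * (l + 1)) := pow_le_pow_right₀ hx1 (by omega)
  rw [← mul_le_mul_iff_left₀ (pow_pos hmpos (l + 1))]
  calc (m : ℝ) ^ a * (((m - (l + 1)).choose (k - (l + 1)) : ℕ) : ℝ) * (m : ℝ) ^ (l + 1)
      = (m : ℝ) ^ a * ((((m - (l + 1)).choose (k - (l + 1)) : ℕ) : ℝ) * (m : ℝ) ^ (l + 1)) := by ring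
    _ ≤ (m : ℝ) ^ a * ((k : ℝ) ^ (l + 1) * (m.choose k : ℝ)) := mul_le_mul_of_nonneg_left hreal (by positivity)
    _ ≤ (x ^ 16) ^ a * ((2 * x ^ 2) ^ (l + 1) * (m.choose k : ℝ)) := by rw [hmx]; gcongr
    _ = ((x ^ 16) ^ a * (2 * x ^ 2) ^ (l + 1)) * (m.choose k : ℝ) := by ring
    _ ≤ epsOf c m * (m.choose k : ℝ) * (m : ℝ) ^ (l + 1) := by
        rw [DenseRegime.epsOf_eq, hmx]
        rw [show 1 / (4 * (x ^ 16) ^ (c + 1)) * (m.choose k : ℝ) * (x ^ 16) ^ (l + 1) =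
            (m.choose k : ℝ) * (x ^ 16) ^ (l + 1) / (4 * (x ^ 16) ^ (c + 1)) by ring]
        rw [le_div_iff₀ (by positivity)]
        calc (x ^ 16) ^ a * (2 * x ^ 2) ^ (l + 1) * (m.choose k : ℝ) * (4 * (x ^ 16) ^ (c + 1))
            = ((x ^ 16) ^ a * (2 * x ^ 2) ^ (l + 1) * (4 * (x ^ 16) ^ (c + 1))) * (m.choose k : ℝ) := by ring
          _ ≤ (x ^ 16) ^ (l + 1) * (m.choose k : ℝ) := mul_le_mul_of_nonneg_right key hC
          _ = (m.choose k : ℝ) * (x ^ 16) ^ (l + 1) := mul_comm _ _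

/-- **THE MINTERM DOOR for polynomially many terms (all `c`; registered ∀-form).** For all `a, c`, eventually
in `m`: every Boolean function of graphs with a DNF of at most `m^a` terms over atoms of `𝒱(lOf m)` satisfies
the single-gate clause of the line at budget `epsOf c m`, with NO gained negative (`sg_of_terms` + each fat
term costs `≤ C(m-(l+1), k-(l+1))` supersets + `polyTerms_budget`). [folklore] -/
theorem sgClause_of_card_terms_le : ∀ a c : ℕ, ∀ᶠ m : ℕ in atTop, ∀ (O : (KEdge m → Bool) → Bool) (𝒯 : Finset (Finset (Finset (Fin m)))), (∀ T ∈ 𝒯, ∀ Z ∈ T, Z ∈ smallSets (Fin m) (lOf m)) → #𝒯 ≤ m ^ a → (∀ x, O x = true ↔ ∃ T ∈ 𝒯, ∀ Z ∈ T, CliquePresent Z x) → ∃ 𝒜 ⊆ smallSets (Fin m) (lOf m), (#(lostPos m (kOf m) O 𝒜) : ℝ) ≤ epsOf c m * (m.choose (kOf m) : ℝ) ∧ gainedNeg m (qOf m) O 𝒜 ≤ epsOf c m := by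
  intro a c
  filter_upwards [polyTerms_budget a c, stub_denseRegime c,
    (DenseRegime.tendsto_rpow_sixteenth).eventually_ge_atTop (2 : ℝ)] with m hB hR hx2 O 𝒯 h𝒯 hcard hO
  obtain ⟨-, -, hkm, -, -, -, -, -, -, -⟩ := hR
  have hlk : lOf m + 1 ≤ kOf m := DenseRegime.lOf_add_one_le_kOf hx2
  obtain ⟨𝒜, h𝒜, hlost, hgain⟩ := sg_of_terms m (kOf m) (lOf m) (qOf m) 𝒯 h𝒯 O hO
  refine ⟨𝒜, h𝒜, ?_, by rw [hgain]; exact epsOf_nonneg c m⟩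
  -- each fat term costs at most `C(m-(l+1), k-(l+1))` supersets
  have hterm : ∀ T ∈ 𝒯.filter (fun T => lOf m < #(T.biUnion id)),
      (m - #(T.biUnion id)).choose (kOf m - #(T.biUnion id)) ≤ (m - (lOf m + 1)).choose (kOf m - (lOf m + 1)) := by
    intro T hT
    have hfat : lOf m + 1 ≤ #(T.biUnion id) := (mem_filter.1 hT).2
    by_cases hUk : #(T.biUnion id) ≤ kOf m
    · exact choose_sub_le_choose_sub hfat hUk hkm
    · push Not at hUk
      rw [Nat.sub_eq_zero_of_le hUk.le, Nat.choose_zero_right]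
      exact Nat.succ_le_of_lt (Nat.choose_pos (by omega))
  calc (#(lostPos m (kOf m) O 𝒜) : ℝ)
      ≤ ((∑ T ∈ 𝒯.filter (fun T => lOf m < #(T.biUnion id)),
          (m - #(T.biUnion id)).choose (kOf m - #(T.biUnion id)) : ℕ) : ℝ) := by exact_mod_cast hlost
    _ ≤ ((#(𝒯.filter fun T => lOf m < #(T.biUnion id)) * (m - (lOf m + 1)).choose (kOf m - (lOf m + 1)) : ℕ) : ℝ) := by
        exact_mod_cast (sum_le_sum hterm).trans (by rw [sum_const, smul_eq_mul])
    _ ≤ (m : ℝ) ^ a * (((m - (lOf m + 1)).choose (kOf m - (lOf m + 1)) : ℕ) : ℝ) := by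
        push_cast
        refine mul_le_mul_of_nonneg_right ?_ (Nat.cast_nonneg _)
        calc (#(𝒯.filter fun T => lOf m < #(T.biUnion id)) : ℝ) ≤ #𝒯 := by
              exact_mod_cast card_le_card (filter_subset _ _)
          _ ≤ ((m ^ a : ℕ) : ℝ) := by exact_mod_cast hcard
          _ = (m : ℝ) ^ a := by push_cast; ring
    _ ≤ epsOf c m * (m.choose (kOf m) : ℝ) := hB

end Summit.PneNP.PneNP.Theorems

end
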